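import Mathlib

/-!
# Characters trivial on a finite-index subgroup separate the points of the quotient
(kernel witness for the group-theoretic half of the standard fact (A10))

Blind cell `pub-hodge-repro2`, seat p4, Tier-5 support. README §8(d): this file uses an
L-value-free non-vanishing device: NO (a kernel check of a standard fact already on the cell's
record).

The standard fact (A10) of `route/T5-route-2.md` §N5.12.6 (owner route-2, sub-step N5) reads: «at
an inert v, conjugate-orthogonal characters of every exact conductor a ≥ 1 exist:
U_E^{a−1}U_{F_v} ⊋ U_E^aU_{F_v} (…), and a character of the finite group U_E/U_E^aU_{F_v}
non-trivial on the image of U_E^{a−1} inflates to E_v^×/F_v^× = U_EF_v^×/F_v^× ≅ U_E/U_{F_v}».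
Its group-theoretic half is: for a subgroup `H` of finite index in an abelian group `U` and a point
`x ∉ H`, there is a character of `U` trivial on `H` and non-trivial at `x` — the characters of the
finite quotient `U ⧸ H` separate its points (Mathlib's `AddChar.exists_apply_ne_zero`), and they
inflate to `U`. The local-field half (`U_E^{a−1}/U_E^a ≅ k_E`, strictly larger than the image of
`U_{F_v}`) is not modelled.

* `inflate H ψq` — a character of `U ⧸ H` as a character of `U` trivial on `H`;
* `inflate_apply_of_mem` — triviality on `H`;
* **`exists_addChar_trivial_on_ne_one`** — `x ∉ H`, `H` of finite index ⇒ `∃ χ : AddChar U ℂ`,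
  `χ|_H = 1` and `χ x ≠ 1`;
* `exists_addChar_trivial_on_ne_one_of_not_le` — the form used: a subgroup `A ≰ H` ⇒ some character
  trivial on `H` is non-trivial on `A` («a character … non-trivial on the image of `U_E^{a−1}`»);
* `forall_addChar_eq_one_iff_mem` — the converse: `x ∈ H` iff every character trivial on `H` is
  trivial at `x` (`H` is the common kernel of the characters trivial on it).

Mathlib only; no sorry; axioms ⊆ {propext, Classical.choice, Quot.sound}.
-/

namespace Summit.Ventures.HodgeRepro2.T5FiniteIndexSeparation

variable {U : Type*} [AddCommGroup U]

/-- The character of `U` obtained from a character `ψq` of `U ⧸ H` (trivial on `H`). -/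
def inflate (H : AddSubgroup U) (ψq : AddChar (U ⧸ H) ℂ) : AddChar U ℂ :=
  ψq.compAddMonoidHom (QuotientAddGroup.mk' H)

/-- `inflate H ψq x = ψq (x : U ⧸ H)`. -/
theorem inflate_apply (H : AddSubgroup U) (ψq : AddChar (U ⧸ H) ℂ) (x : U) :
    inflate H ψq x = ψq (x : U ⧸ H) := rfl

/-- An inflated character is trivial on `H`. -/
theorem inflate_apply_of_mem (H : AddSubgroup U) (ψq : AddChar (U ⧸ H) ℂ) {h : U} (hh : h ∈ H) :
    inflate H ψq h = 1 := by
  rw [inflate_apply, (QuotientAddGroup.eq_zero_iff h).mpr hh, AddChar.map_zero_eq_one]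

/-- THE GROUP-THEORETIC HALF OF (A10): for `H` of finite index and `x ∉ H` there is a character of
`U` trivial on `H` and non-trivial at `x`. -/
theorem exists_addChar_trivial_on_ne_one (H : AddSubgroup U) [H.FiniteIndex] {x : U}
    (hx : x ∉ H) : ∃ χ : AddChar U ℂ, (∀ h ∈ H, χ h = 1) ∧ χ x ≠ 1 := by
  have hx' : (x : U ⧸ H) ≠ 0 := by
    rwa [Ne, QuotientAddGroup.eq_zero_iff]
  obtain ⟨ψq, hψq⟩ := AddChar.exists_apply_ne_zero.mpr hx'
  exact ⟨inflate H ψq, fun h hh => inflate_apply_of_mem H ψq hh, hψq⟩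

/-- The form used in (A10): if a subgroup `A` is not contained in `H` (of finite index), some
character of `U` trivial on `H` is non-trivial on `A`. -/
theorem exists_addChar_trivial_on_ne_one_of_not_le (H A : AddSubgroup U) [H.FiniteIndex]
    (hA : ¬ A ≤ H) : ∃ χ : AddChar U ℂ, (∀ h ∈ H, χ h = 1) ∧ ∃ a ∈ A, χ a ≠ 1 := by
  obtain ⟨a, haA, haH⟩ := SetLike.not_le_iff_exists.mp hA
  obtain ⟨χ, hχH, hχa⟩ := exists_addChar_trivial_on_ne_one H haH
  exact ⟨χ, hχH, a, haA, hχa⟩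

/-- `H` is the common kernel of the characters trivial on it: `x ∈ H` iff every character of `U`
trivial on `H` is trivial at `x`. -/
theorem forall_addChar_eq_one_iff_mem (H : AddSubgroup U) [H.FiniteIndex] (x : U) :
    (∀ χ : AddChar U ℂ, (∀ h ∈ H, χ h = 1) → χ x = 1) ↔ x ∈ H := by
  constructor
  · intro hall
    by_contra hx
    obtain ⟨χ, hχH, hχx⟩ := exists_addChar_trivial_on_ne_one H hx
    exact hχx (hall χ hχH)
  · intro hx χ hχ
    exact hχ x hx

end Summit.Ventures.HodgeRepro2.T5FiniteIndexSeparation
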